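import Literature.Topology.FourManifolds.IsotopyProofs
import Literature.Topology.FourManifolds.ChartTransport
import Mathlib.Analysis.Normed.Module.FiniteDimension
import HarnessLib

/-!
# Transport of ambient isotopies: along a diffeomorphism, and of a ball-supported ambient
# isotopy of the model along a chart

Topic `Literature/Topology/FourManifolds`.  Two constructions on the tree's
`Literature.Topology.FourManifolds.AmbientIsotopy` (`Isotopy.lean`), needed to transport the two
compactly supported ambient isotopies of `Rⁿ` of Milnor's Theorem 5.6
(`MilnorLocalIsotopyProof.lean`, `MilnorLocalIsotopyPair.lean`) to a level `f⁻¹(b₂)` of the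
cobordism in the proof of Thm. 5.4, Assertion 6 (Milnor, *Lectures on the h-cobordism theorem*
(1965), PDF pp. 31–32: the isotopy of `h₀⁻¹h` near `p₁` *"specifies the required deformation of
`h`"*), in the flow-free chart form of the tree (`ChartTransport.lean`,
`DiffeotopyTransport.lean`; Hirsch, *Differential Topology* (1976), Ch. 8 §1, Thms. 1.3–1.4: a
compactly supported diffeotopy of an open subset extends by the identity):

* `AmbientIsotopy.transfer` — conjugation `e ∘ F_t ∘ e⁻¹` of an ambient isotopy of `N` by a
  diffeomorphism `e : N ≅ N'`, an ambient isotopy of `N'`;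
* `AmbientIsotopy.chartTransport` — for a chart `φ : M ⊇ U → E` of a manifold `M` modelled on
  any real model with corners `I` (boundary allowed; `E` a finite-dimensional space, e.g. an
  interior chart), smooth with smooth inverse on its domain and target, and an ambient isotopy `G` of the model `E` all of whose stages are
  the identity off a closed ball `B̄(0, R) ⊆ φ.target`, the stagewise transports
  `φ⁻¹ ∘ G_t ∘ φ` on `U`, the identity elsewhere (`Literature.Topology.FourManifolds.chartTransport`),
  form an ambient isotopy of `M`.  Unlike `Diffeotopy.chartTransport` (`DiffeotopyTransport.lean`)
  the target of the chart need not be all of `E`: an injective self-map of `E` which is the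
  identity off `B̄(0, R)` maps `B̄(0, R)` into itself (`norm_apply_le_of_eq_self_off_ball`), so the
  stages never leave the target.

Everything here is proved; no named facts.

## References

* M. W. Hirsch, *Differential Topology*, GTM 33 (1976), Ch. 8 §1, pp. 178–180, Thms. 1.3–1.4.
  [HirschDT1976]
* J. Milnor, *Lectures on the h-cobordism theorem* (1965), proof of Thm. 5.4, Assertion 6
  (PDF pp. 31–32). [MilnorHCobordism1965]
-/

open scoped Manifold ContDiff Topology
open Set Function Filter Metric

noncomputable section

namespace Literature.Topology.FourManifolds

/-! ### Conjugation by a diffeomorphism -/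

section Conj

variable {EN HN EN' HN' : Type*} [NormedAddCommGroup EN] [NormedSpace ℝ EN] [TopologicalSpace HN]
  [NormedAddCommGroup EN'] [NormedSpace ℝ EN'] [TopologicalSpace HN']
  {J : ModelWithCorners ℝ EN HN} {J' : ModelWithCorners ℝ EN' HN'}
  {N : Type*} [TopologicalSpace N] [ChartedSpace HN N]
  {N' : Type*} [TopologicalSpace N'] [ChartedSpace HN' N']

/-- **Transferring an ambient isotopy along a diffeomorphism**: for an ambient isotopy `F` of
`N` and a diffeomorphism `e : N ≅ N'` onto another manifold, the family `e ∘ F_t ∘ e⁻¹` is an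
ambient isotopy of `N'` (the tree's `AmbientIsotopy.conjDiffeo`, `LocalLinearisationIsotopy.lean`,
is the case `N' = N`). [cite: HirschDT1976, Ch. 8 §1, p. 178] -/
def AmbientIsotopy.transfer (F : AmbientIsotopy J N) (e : N ≃ₘ^∞⟮J, J'⟯ N') : AmbientIsotopy J' N' where
  toFun t y := e (F.toFun t (e.symm y))
  contMDiff :=
    e.contMDiff.comp (F.contMDiff.comp (contMDiff_fst.prodMk (e.symm.contMDiff.comp contMDiff_snd)))
  bijective t := e.bijective.comp ((F.bijective t).comp e.symm.bijective)
  isLocalDiffeomorph t := fun y =>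
    show IsLocalDiffeomorphAt J' J' ∞ (e ∘ (F.toFun t ∘ e.symm)) y from
      ((e.symm.isLocalDiffeomorph y).comp (K := J) (P := N)
        ((F.isLocalDiffeomorph t) (e.symm y))).comp (K := J') (P := N')
          (e.isLocalDiffeomorph _)
  map_zero := by
    funext y
    simp [F.map_zero]

/-- Stages of the conjugated isotopy (definitional). [folklore] -/
@[simp]
theorem AmbientIsotopy.transfer_toFun (F : AmbientIsotopy J N) (e : N ≃ₘ^∞⟮J, J'⟯ N') (t : ℝ) (y : N') :
    (F.transfer e).toFun t y = e (F.toFun t (e.symm y)) := rfl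

end Conj

/-! ### Self-maps of the model supported in a ball -/

section Ball

variable {E : Type*} [NormedAddCommGroup E]

/-- **An injective self-map of `E` which is the identity off `B̄(0, R)` (`R ≤ ‖y‖ → s y = y`)
does not increase the norm of points of norm `≤ R` beyond `R`** — it maps the closed ball into
itself: if `‖s y‖ ≥ R` then `s (s y) = s y`, so `s y = y`. [folklore] -/
theorem norm_apply_lt_of_eq_self_off_ball {s : E → E} (hinj : Injective s) {R : ℝ}
    (hs : ∀ y, R ≤ ‖y‖ → s y = y) {y : E} (hy : ‖y‖ < R) : ‖s y‖ < R := by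
  by_contra hle
  have h1 : s (s y) = s y := hs _ (not_lt.1 hle)
  have h2 : s y = y := hinj h1
  rw [h2] at hle
  exact hle hy

/-- The same with non-strict inequalities. [folklore] -/
theorem norm_apply_le_of_eq_self_off_ball {s : E → E} (hinj : Injective s) {R : ℝ}
    (hs : ∀ y, R ≤ ‖y‖ → s y = y) {y : E} (hy : ‖y‖ ≤ R) : ‖s y‖ ≤ R := by
  rcases hy.lt_or_eq with hlt | heq
  · exact (norm_apply_lt_of_eq_self_off_ball hinj hs hlt).le
  · rw [hs y heq.ge, heq]

/-- Such a map sends any set containing `B̄(0, R)` into itself. [folklore] -/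
theorem mapsTo_of_eq_self_off_ball {s : E → E} (hinj : Injective s) {R : ℝ}
    (hs : ∀ y, R ≤ ‖y‖ → s y = y) {T : Set E} (hT : closedBall (0 : E) R ⊆ T) :
    MapsTo s T T := by
  intro y hy
  by_cases hR : R ≤ ‖y‖
  · rw [hs y hR]
    exact hy
  · exact hT (mem_closedBall_zero_iff.2 (norm_apply_le_of_eq_self_off_ball hinj hs (not_le.1 hR).le))

/-- The inverse of a bijection which is the identity off `B̄(0, R)` is the identity there too.
[folklore] -/
theorem symm_eq_self_off_ball (s : E ≃ E) {R : ℝ} (hs : ∀ y, R ≤ ‖y‖ → s y = y)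
    (y : E) (hy : R ≤ ‖y‖) : s.symm y = y := by
  conv_lhs => rw [← hs y hy]
  exact s.symm_apply_apply y

end Ball

/-! ### Transport of a ball-supported ambient isotopy of the model along a chart -/

section TransportAlgebra

variable {E : Type*} [NormedAddCommGroup E] {M : Type*} [TopologicalSpace M]
  {φ : OpenPartialHomeomorph M E}

/-- Transports of mutually inverse maps are mutually inverse, as soon as the inner one maps the
target of the chart into itself. [folklore] -/
theorem chartTransport_chartTransport_of_mapsTo {s t : E → E} (hst : ∀ y, t (s y) = y)
    (hs : MapsTo s φ.target φ.target) (x : M) :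
    chartTransport φ t (chartTransport φ s x) = x := by
  by_cases hxs : x ∈ φ.source
  · have h1 : s (φ x) ∈ φ.target := hs (φ.map_source hxs)
    rw [chartTransport_of_mem s hxs, chartTransport_of_mem t (φ.map_target h1), φ.right_inv h1,
      hst, φ.left_inv hxs]
  · rw [chartTransport_of_not_mem s hxs, chartTransport_of_not_mem t hxs]

end TransportAlgebra

section Transport

variable {E : Type*} [NormedAddCommGroup E] [NormedSpace ℝ E] [FiniteDimensional ℝ E]
  {EM : Type*} [NormedAddCommGroup EM] [NormedSpace ℝ EM] {HM : Type*} [TopologicalSpace HM]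
  {I : ModelWithCorners ℝ EM HM}
  {M : Type*} [TopologicalSpace M] [ChartedSpace HM M] [T2Space M]
  {φ : OpenPartialHomeomorph M E}

/-- **Joint smoothness of the stagewise transport of a smooth family supported in a closed ball
inside the target**: for `F : ℝ → E → E` jointly smooth with `F_t = id` off `B̄(0, R)`,
`B̄(0, R) ⊆ φ.target`, each `F_t` mapping the target into itself, the family
`(t, x) ↦ chartTransport φ (F t) x` is jointly smooth (near `ℝ × U` it is `φ⁻¹ ∘ F_t ∘ φ`, near
the closed set `ℝ × (M ∖ φ⁻¹(B̄(0, R)))` it is the identity). [cite: HirschDT1976, Ch. 8 §1, Thm. 1.3] -/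
theorem contMDiff_uncurry_chartTransport_of_subset (hφ : ContMDiffOn I 𝓘(ℝ, E) ∞ φ φ.source)
    (hφ' : ContMDiffOn 𝓘(ℝ, E) I ∞ φ.symm φ.target) {R : ℝ}
    (hR : closedBall (0 : E) R ⊆ φ.target) {F : ℝ → E → E}
    (hF : ContMDiff (𝓘(ℝ, ℝ).prod 𝓘(ℝ, E)) 𝓘(ℝ, E) ∞ (uncurry F))
    (hFs : ∀ t y, R ≤ ‖y‖ → F t y = y) (hFt : ∀ t, MapsTo (F t) φ.target φ.target) :
    ContMDiff (𝓘(ℝ, ℝ).prod I) I ∞ (uncurry fun t x => chartTransport φ (F t) x) := by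
  intro p
  obtain ⟨t, x⟩ := p
  by_cases hxs : x ∈ φ.source
  · -- near `ℝ × U` the family is `φ⁻¹ ∘ F_t ∘ φ`
    have hev : (uncurry fun t x => chartTransport φ (F t) x) =ᶠ[𝓝 (t, x)]
        fun q : ℝ × M => φ.symm (F q.1 (φ q.2)) := by
      filter_upwards [prod_mem_nhds Filter.univ_mem (φ.open_source.mem_nhds hxs)] with q hq
      exact chartTransport_of_mem (F q.1) hq.2
    refine ContMDiffAt.congr_of_eventuallyEq ?_ hev
    have h1 : ContMDiffAt (𝓘(ℝ, ℝ).prod I) (𝓘(ℝ, ℝ).prod 𝓘(ℝ, E)) ∞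
        (fun q : ℝ × M => (q.1, φ q.2)) (t, x) :=
      contMDiffAt_fst.prodMk ((hφ.contMDiffAt (φ.open_source.mem_nhds hxs)).comp (t, x)
        contMDiffAt_snd)
    have h2 : ContMDiffAt (𝓘(ℝ, ℝ).prod I) 𝓘(ℝ, E) ∞ (fun q : ℝ × M => F q.1 (φ q.2)) (t, x) :=
      hF.contMDiffAt.comp (t, x) h1
    have hmem : F t (φ x) ∈ φ.target := hFt t (φ.map_source hxs)
    exact (hφ'.contMDiffAt (φ.open_target.mem_nhds hmem)).comp (t, x) h2
  · -- near `ℝ × (M ∖ φ⁻¹(B̄(0, R)))` the family is the identity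
    have hK : IsClosed (φ.symm '' closedBall (0 : E) R) :=
      ((isCompact_closedBall (0 : E) R).image_of_continuousOn (φ.continuousOn_symm.mono hR)).isClosed
    have hxK : x ∉ φ.symm '' closedBall (0 : E) R := by
      rintro ⟨y, hy, rfl⟩
      exact hxs (φ.map_target (hR hy))
    have hev : (uncurry fun t x => chartTransport φ (F t) x) =ᶠ[𝓝 (t, x)]
        fun q : ℝ × M => q.2 := by
      filter_upwards [prod_mem_nhds Filter.univ_mem (hK.isOpen_compl.mem_nhds hxK)] with q hq
      exact chartTransport_eq_self (hFs q.1) hq.2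
    exact contMDiffAt_snd.congr_of_eventuallyEq hev

/-- The non-parametric case: the transport of a smooth self-map of `E` supported in
`B̄(0, R) ⊆ φ.target` and mapping the target into itself is smooth. [cite: HirschDT1976, Ch. 8 §1, Thm. 1.3] -/
theorem contMDiff_chartTransport_of_subset (hφ : ContMDiffOn I 𝓘(ℝ, E) ∞ φ φ.source)
    (hφ' : ContMDiffOn 𝓘(ℝ, E) I ∞ φ.symm φ.target) {R : ℝ}
    (hR : closedBall (0 : E) R ⊆ φ.target) {s : E → E} (hsm : ContMDiff 𝓘(ℝ, E) 𝓘(ℝ, E) ∞ s)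
    (hs : ∀ y, R ≤ ‖y‖ → s y = y) (hst : MapsTo s φ.target φ.target) :
    ContMDiff I I ∞ (chartTransport φ s) := by
  have h := contMDiff_uncurry_chartTransport_of_subset hφ hφ' hR (F := fun _ : ℝ => s)
    (hsm.comp contMDiff_snd) (fun _ y hy => hs y hy) fun _ => hst
  exact h.comp ((contMDiff_const (c := (0 : ℝ))).prodMk contMDiff_id)

variable (φ) in
/-- **The stage of the transported isotopy as a diffeomorphism of `M`** (transport of a
diffeomorphism `s` of `E` supported in `B̄(0, R) ⊆ φ.target`, with inverse the transport of
`s⁻¹`). [cite: HirschDT1976, Ch. 8 §1, Thm. 1.3] -/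
def chartTransportDiffeomorphOfSubset (hφ : ContMDiffOn I 𝓘(ℝ, E) ∞ φ φ.source)
    (hφ' : ContMDiffOn 𝓘(ℝ, E) I ∞ φ.symm φ.target) {R : ℝ}
    (hR : closedBall (0 : E) R ⊆ φ.target) (s : E ≃ₘ⟮𝓘(ℝ, E), 𝓘(ℝ, E)⟯ E)
    (hs : ∀ y, R ≤ ‖y‖ → s y = y) : M ≃ₘ⟮I, I⟯ M where
  toFun := chartTransport φ s
  invFun := chartTransport φ s.symm
  left_inv := chartTransport_chartTransport_of_mapsTo s.symm_apply_apply
    (mapsTo_of_eq_self_off_ball s.injective hs hR)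
  right_inv := chartTransport_chartTransport_of_mapsTo s.apply_symm_apply
    (mapsTo_of_eq_self_off_ball s.symm.injective
      (symm_eq_self_off_ball s.toEquiv hs) hR)
  contMDiff_toFun := contMDiff_chartTransport_of_subset hφ hφ' hR s.contMDiff hs
    (mapsTo_of_eq_self_off_ball s.injective hs hR)
  contMDiff_invFun := contMDiff_chartTransport_of_subset hφ hφ' hR s.symm.contMDiff
    (symm_eq_self_off_ball s.toEquiv hs)
    (mapsTo_of_eq_self_off_ball s.symm.injective (symm_eq_self_off_ball s.toEquiv hs) hR)

/-- The stage diffeomorphism is, as a function, the transport (definitional). [folklore] -/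
@[simp]
theorem coe_chartTransportDiffeomorphOfSubset (hφ : ContMDiffOn I 𝓘(ℝ, E) ∞ φ φ.source)
    (hφ' : ContMDiffOn 𝓘(ℝ, E) I ∞ φ.symm φ.target) {R : ℝ}
    (hR : closedBall (0 : E) R ⊆ φ.target) (s : E ≃ₘ⟮𝓘(ℝ, E), 𝓘(ℝ, E)⟯ E)
    (hs : ∀ y, R ≤ ‖y‖ → s y = y) :
    ⇑(chartTransportDiffeomorphOfSubset φ hφ hφ' hR s hs) = chartTransport φ s := rfl

variable (φ) in
/-- **Transport of a ball-supported ambient isotopy of the model along a chart.**  Let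
`φ : M ⊇ U → E` be a chart, smooth with smooth inverse (on its domain and target), and `G` an
ambient isotopy of `E` all of whose stages are the identity off a closed ball
`B̄(0, R) ⊆ φ.target`.  Then the stagewise transports `chartTransport φ (G_t)` — `φ⁻¹ ∘ G_t ∘ φ`
on `U`, the identity elsewhere — form an ambient isotopy of `M` (the extension by the identity of
a compactly supported diffeotopy of the open subset `U`, Hirsch (1976), Ch. 8 §1, Thms. 1.3–1.4).
[cite: HirschDT1976, Ch. 8 §1, Thm. 1.3] -/
def AmbientIsotopy.chartTransport (hφ : ContMDiffOn I 𝓘(ℝ, E) ∞ φ φ.source)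
    (hφ' : ContMDiffOn 𝓘(ℝ, E) I ∞ φ.symm φ.target) {R : ℝ}
    (hR : closedBall (0 : E) R ⊆ φ.target) (G : AmbientIsotopy 𝓘(ℝ, E) E)
    (hG : ∀ t y, R ≤ ‖y‖ → G.toFun t y = y) : AmbientIsotopy I M where
  toFun t := Literature.Topology.FourManifolds.chartTransport φ (G.toFun t)
  contMDiff := contMDiff_uncurry_chartTransport_of_subset hφ hφ' hR G.contMDiff hG
    fun t => mapsTo_of_eq_self_off_ball (G.bijective t).1 (hG t) hR
  bijective t := (chartTransportDiffeomorphOfSubset φ hφ hφ' hR (G.toDiffeomorph t) (hG t)).bijective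
  isLocalDiffeomorph t :=
    (chartTransportDiffeomorphOfSubset φ hφ hφ' hR (G.toDiffeomorph t) (hG t)).isLocalDiffeomorph
  map_zero := by
    funext x
    rw [G.map_zero]
    by_cases hx : x ∈ φ.source
    · rw [chartTransport_of_mem _ hx, id, φ.left_inv hx]
      rfl
    · exact chartTransport_of_not_mem _ hx

/-- Stages of the transported isotopy (definitional). [folklore] -/
@[simp]
theorem AmbientIsotopy.chartTransport_toFun (hφ : ContMDiffOn I 𝓘(ℝ, E) ∞ φ φ.source)
    (hφ' : ContMDiffOn 𝓘(ℝ, E) I ∞ φ.symm φ.target) {R : ℝ}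
    (hR : closedBall (0 : E) R ⊆ φ.target) (G : AmbientIsotopy 𝓘(ℝ, E) E)
    (hG : ∀ t y, R ≤ ‖y‖ → G.toFun t y = y) (t : ℝ) :
    (G.chartTransport φ hφ hφ' hR hG).toFun t =
      Literature.Topology.FourManifolds.chartTransport φ (G.toFun t) := rfl

/-- On the chart domain the transported stage is `φ⁻¹ ∘ G_t ∘ φ`. [folklore] -/
theorem AmbientIsotopy.chartTransport_toFun_of_mem (hφ : ContMDiffOn I 𝓘(ℝ, E) ∞ φ φ.source)
    (hφ' : ContMDiffOn 𝓘(ℝ, E) I ∞ φ.symm φ.target) {R : ℝ}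
    (hR : closedBall (0 : E) R ⊆ φ.target) (G : AmbientIsotopy 𝓘(ℝ, E) E)
    (hG : ∀ t y, R ≤ ‖y‖ → G.toFun t y = y) (t : ℝ) {x : M} (hx : x ∈ φ.source) :
    (G.chartTransport φ hφ hφ' hR hG).toFun t x = φ.symm (G.toFun t (φ x)) :=
  chartTransport_of_mem _ hx

/-- Off the chart domain the transported stage is the identity. [folklore] -/
theorem AmbientIsotopy.chartTransport_toFun_of_not_mem
    (hφ : ContMDiffOn I 𝓘(ℝ, E) ∞ φ φ.source)
    (hφ' : ContMDiffOn 𝓘(ℝ, E) I ∞ φ.symm φ.target) {R : ℝ}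
    (hR : closedBall (0 : E) R ⊆ φ.target) (G : AmbientIsotopy 𝓘(ℝ, E) E)
    (hG : ∀ t y, R ≤ ‖y‖ → G.toFun t y = y) (t : ℝ) {x : M} (hx : x ∉ φ.source) :
    (G.chartTransport φ hφ hφ' hR hG).toFun t x = x :=
  chartTransport_of_not_mem _ hx

/-- Off `φ⁻¹(B̄(0, R))` the transported stage is the identity. [folklore] -/
theorem AmbientIsotopy.chartTransport_toFun_eq_self (hφ : ContMDiffOn I 𝓘(ℝ, E) ∞ φ φ.source)
    (hφ' : ContMDiffOn 𝓘(ℝ, E) I ∞ φ.symm φ.target) {R : ℝ}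
    (hR : closedBall (0 : E) R ⊆ φ.target) (G : AmbientIsotopy 𝓘(ℝ, E) E)
    (hG : ∀ t y, R ≤ ‖y‖ → G.toFun t y = y) (t : ℝ) {x : M}
    (hx : x ∉ φ.symm '' closedBall (0 : E) R) :
    (G.chartTransport φ hφ hφ' hR hG).toFun t x = x :=
  chartTransport_eq_self (hG t) hx

/-- The transported stage at a point of the chart domain stays in the chart domain. [folklore] -/
theorem AmbientIsotopy.chartTransport_toFun_mem_source
    (hφ : ContMDiffOn I 𝓘(ℝ, E) ∞ φ φ.source)
    (hφ' : ContMDiffOn 𝓘(ℝ, E) I ∞ φ.symm φ.target) {R : ℝ}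
    (hR : closedBall (0 : E) R ⊆ φ.target) (G : AmbientIsotopy 𝓘(ℝ, E) E)
    (hG : ∀ t y, R ≤ ‖y‖ → G.toFun t y = y) (t : ℝ) {x : M} (hx : x ∈ φ.source) :
    (G.chartTransport φ hφ hφ' hR hG).toFun t x ∈ φ.source := by
  rw [AmbientIsotopy.chartTransport_toFun_of_mem hφ hφ' hR G hG t hx]
  exact φ.map_target (mapsTo_of_eq_self_off_ball (G.bijective t).1 (hG t) hR (φ.map_source hx))

end Transport

end Literature.Topology.FourManifolds
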